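import Summits.QuantumFields.YangMills.Theorems.GrossTransferStubLinTestAssembly
import Summits.QuantumFields.YangMills.Theorems.UnitScaleGibbsBlockPlaquetteLinWeightSupport
import Summits.QuantumFields.YangMills.Theorems.UnitScaleGibbsDressedEventSplit
import HarnessLib

/-!
# `GrossTransferStubLinTestProxySide` — KNIT-E2 SPLIT FILE (Q): THE PROXY SIDE OF `main_estimate` AS ONE REAL ROW
# (LINE 28 «GrossTransfer», `stub_linTest`; crux `UnitScaleTilt.HistoryTailL` stmt-QuantumFields-19936 ∕ `MeanDeviationL` stmt-QuantumFields-23083)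

Cell `ym3-torus` (YM ladder rung R3 = continuum SU(2) Yang–Mills on the three-torus — a RUNG, NOT the Clay problem: not d = 4, not infinite volume,
not a mass gap); width seat `ym-ust-19936-w2` (gen 16); helper `--supports stmt-QuantumFields-23083`.  THEOREMS ONLY (0 `def`, 0 `sorry`, default
heartbeats), no norm scope opened: the operator norm of ✓P-LOC's conclusion never surfaces (it is consumed by ✓`dist1_le_of_linProxy`), so the
Frobenius-scoped package file can `exact` these rows (the gate's 400-line lint forces `main_estimate`'s P1–P2 block out of the package file; this is it).

* §1 `plaq_eq_of_cone` — `⟨c j, a.μ, a.ν⟩ = a` for a cone `c` under `a`; ★ `dist1_plaqHol_le_of_linWeight_ne_zero` — on the `θ`-small dressing box every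
  plaquette carrying averaging weight is `θ`-small for the DRESSED field `V = U^{axialGauge U lo hi}` (✓KNIT-A2 `exists_castSite_of_linWeight_ne_zero` + the
  P-LOC margins + gauge invariance of `dist₁(U(∂p))`).
* §2 ★★★ `proxy_side` — P1a + P1b + P2 + the second-order term, END TO END: under ✓P-LOC's hypotheses (box `hi ≤ lo + n₀`, `n₀ < sitesPerDir 0`,
  `PlaqSmallOn (boxPlaqs lo hi) θ U`, cone `c` under `a` with base `castSite z₀`, margins, the two windows `hwin`∕`hwinδ`) and `j ≤ m + K`:
  `dist₁(Ū^j(∂a)) ≤ Σ_α |Σ_p w_p·Re tr((iσ_α)(V(∂p) − 1))| + ½·(L·L)^j·θ² + REM` and `0 ≤ REM`, `REM = C₁(L)·D(L)^j·((1+(d−1)n₀)θ)²` (✓P-LOC's remainder,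
  verbatim) — the hypothesis `h12`∕`hQ`∕`hρ` block of ✓`GrossTransferStubLinTestAssembly.sq_le_of_rows`.

HONEST SCOPE.  Bookkeeping over landed files by name (✓P-LOC p741009, ✓LIN-ID via ✓p753927, ✓KNIT-A2 p747092, ✓`dist1_plaqHol_iter_dressed`); NOTHING of
`main_estimate`, `stub_linTest`, 23083∕23133∕23134, `HistoryTailL` (19936), the rung R3, d = 4, a continuum limit or a mass gap is proved here; the
Yang–Mills mass gap is NOT proved.
References: T. Bałaban, CMP 98 (1985) 17–51, Prop. 1 (51) pp. 25–26 and (19) p. 21 [Balaban1985Averaging]; CMP 109 (1987) 249–301, (0.1)–(0.4), (0.11)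
pp. 251–253 [Balaban1987RG1]; L. Gross, CMP 92 (1983) 137–162, Thm 2.2 [GrossCMP1983].
-/

noncomputable section

set_option autoImplicit false

open scoped BigOperators
open Complex Finset
open Literature.MathematicalPhysics.QuantumFieldTheory.Balaban1983to89
open Literature.MathematicalPhysics.QuantumFieldTheory.Balaban1983to89.BlockAveraging (blockAvg)
open Literature.MathematicalPhysics.QuantumFieldTheory.Balaban1983to89.ExpMeanLog (expMeanLogSU deltaSU)
open Literature.MathematicalPhysics.QuantumFieldTheory.Balaban1983to89.T4AxialGaugeSmallField (castSite boxPlaqs axialGauge)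
open Literature.MathematicalPhysics.QuantumFieldTheory.Balaban1983to89.B7Prop1Explicit (e)
open Literature.MathematicalPhysics.QuantumFieldTheory.Balaban1983to89.B4Eq19LatticeOperators (abs_unitVec_apply_le)
open Literature.MathematicalPhysics.QuantumFieldTheory.Balaban1983to89.B10Eq18SigmaSU2 (pauli)
open Summit.QuantumFields.YangMills.Theorems.UnitScaleGibbsBlockPlaquetteLinWeight (linWeight linWeight_nonneg sum_linWeight)
open Summit.QuantumFields.YangMills.Theorems.UnitScaleGibbsBlockPlaquetteLinWeightSupport (exists_castSite_of_linWeight_ne_zero)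
open Summit.QuantumFields.YangMills.Theorems.UnitScaleGibbsBlockPlaquetteLinearisationOnBoxEvent (norm_iter_plaqHol_sub_one_sub_linProxy_le_of_plaqSmallOn_box)
open Summit.QuantumFields.YangMills.Theorems.GrossTransferStubLinTestAssembly (dist1_le_pauli_read half_sum_abs_mul_sq_le)
open Summit.QuantumFields.YangMills.Theorems.UnitScaleGibbsDressedEventSplit (dist1_plaqHol_iter_dressed)

namespace Summit.QuantumFields.YangMills.Theorems.GrossTransferStubLinTestProxySide

variable {P : Params}

/-! ## §1 The cone's plaquette and the smallness of the weighted plaquettes for the dressed field -/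

/-- The level-`j` plaquette of a cone `c` under `a` IS `a`. [folklore] -/
theorem plaq_eq_of_cone {j : ℕ} (a : Plaq P j) (c : (i : ℕ) → Site P i) (hcj : c j = a.src) :
    (⟨c j, a.μ, a.ν, a.hμν⟩ : Plaq P j) = a := by
  cases a; simp only at hcj; simp [hcj]

/-- ★ **EVERY WEIGHTED PLAQUETTE IS `θ`-SMALL FOR THE DRESSED FIELD.**  If `linWeight j a p ≠ 0` then `p = ⟨castSite y, ·, ·⟩` with `|y − z₀| ≤ R₀(j)`
(✓KNIT-A2), so with the P-LOC margins `lo + R₀ ≤ z₀`, `z₀ + R₀ + 2 ≤ hi` the plaquette lies in `boxPlaqs lo hi`; on `PlaqSmallOn (boxPlaqs lo hi) θ U` its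
holonomy under `V = U^{axialGauge U lo hi}` is within `θ` of `1` (`dist₁` is conjugation invariant). [cite: Balaban1985Averaging, (11) p.19] -/
theorem dist1_plaqHol_le_of_linWeight_ne_zero (U : GaugeField P 0 (Matrix.specialUnitaryGroup (Fin 2) ℂ)) {lo hi : Fin P.d → ℤ} {θ : ℝ}
    (hU : PlaqSmallOn (boxPlaqs lo hi) θ U) {j : ℕ} (a : Plaq P j) (c : (i : ℕ) → Site P i) (hcj : c j = a.src)
    (hc : ∀ i, i < j → c i = emb (c (i + 1))) (z₀ : Fin P.d → ℤ) (hz : c 0 = castSite z₀)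
    (hlo : ∀ κ, lo κ + (((P.d + 4) * P.L + 2) * ∑ k ∈ Finset.range j, P.L ^ k : ℕ) ≤ z₀ κ)
    (hhi : ∀ κ, z₀ κ + (((P.d + 4) * P.L + 2) * ∑ k ∈ Finset.range j, P.L ^ k : ℕ) + 2 ≤ hi κ)
    (p : Plaq P 0) (hp : linWeight j a p ≠ 0) :
    GaugeGroup.dist1 (GaugeField.plaqHol (GaugeField.gaugeAct (axialGauge U lo hi) U) p) ≤ θ := by
  obtain ⟨-, -, y, hy, hsrc⟩ := exists_castSite_of_linWeight_ne_zero j a c hcj hc z₀ hz p hp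
  have hmem : p ∈ boxPlaqs lo hi := by
    refine ⟨y, fun κ => ?_, fun κ => ?_, hsrc⟩
    · have h := hy κ; rw [abs_le] at h; linarith [hlo κ, h.1]
    · have h := hy κ; rw [abs_le] at h
      have h1 : (e p.μ : Fin P.d → ℤ) κ ≤ 1 := le_trans (le_abs_self _) (abs_unitVec_apply_le p.μ κ)
      have h2 : (e p.ν : Fin P.d → ℤ) κ ≤ 1 := le_trans (le_abs_self _) (abs_unitVec_apply_le p.ν κ)
      simp only [Pi.add_apply]; linarith [hhi κ, h.2]
  rw [T4ReTrLipUnitary.plaqHol_gaugeAct, GaugeGroup.dist1_conj]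
  exact (hU p hmem).le

/-! ## §2 The proxy side, end to end -/

/-- ★★★ **(Q) THE PROXY SIDE OF `main_estimate`, ONE REAL ROW.**  Under ✓P-LOC's hypotheses (non-wrapping box `hi ≤ lo + n₀`, `n₀ < sitesPerDir 0`, the
event `PlaqSmallOn (boxPlaqs lo hi) θ U`, a cone `c` under the level-`j` plaquette `a` with base `castSite z₀` and margins `lo + R₀ ≤ z₀`, `z₀ + R₀ + 2 ≤ hi`,
the windows `M^j(1+(d−1)n₀)θ ≤ 1` and `(((d+4)L)²∕4)·M^j(1+(d−1)n₀)θ ≤ δ_N∕2`) and `j ≤ m + K`, with `V := U^{axialGauge U lo hi}` and `w_p := linWeight j a p`: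
`dist₁(Ū^j(∂a)) ≤ Σ_α |Σ_p w_p·Re tr((iσ_α)(V(∂p) − 1))| + ½·(L·L)^j·θ² + REM` and `0 ≤ REM`, where `REM` is ✓P-LOC's remainder
`C₁(L)·D(L)^j·((1+(d−1)n₀)θ)²` verbatim — dressing invariance (P1a), ✓P-LOC (P1b), ✓LIN-ID in `dist₁` letters (P2, ✓`dist1_le_pauli_read`) and the
second-order term `½Σ_p|w_p|dist₁(V∂p)² ≤ ½(Σ_p w_p)θ²` (§1 + ✓`sum_linWeight`).
[cite: Balaban1985Averaging, Prop. 1 (51) pp.25-26; Balaban1987RG1, (0.1)-(0.4) pp.251-253; GrossCMP1983, Thm 2.2] -/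
theorem proxy_side (U : GaugeField P 0 (Matrix.specialUnitaryGroup (Fin 2) ℂ)) {lo hi : Fin P.d → ℤ} {n₀ : ℕ}
    (hn : ∀ κ, hi κ ≤ lo κ + n₀) (hnN : n₀ < P.sitesPerDir 0) {θ : ℝ} (hθ : 0 ≤ θ)
    (hU : PlaqSmallOn (boxPlaqs lo hi) θ U) {j : ℕ} (hjK : j ≤ P.m + P.K) (a : Plaq P j) (c : (i : ℕ) → Site P i) (hcj : c j = a.src)
    (hc : ∀ i, i < j → c i = emb (c (i + 1))) (z₀ : Fin P.d → ℤ) (hz : c 0 = castSite z₀)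
    (hlo : ∀ κ, lo κ + (((P.d + 4) * P.L + 2) * ∑ k ∈ Finset.range j, P.L ^ k : ℕ) ≤ z₀ κ)
    (hhi : ∀ κ, z₀ κ + (((P.d + 4) * P.L + 2) * ∑ k ∈ Finset.range j, P.L ^ k : ℕ) + 2 ≤ hi κ)
    (hwin : ((P.L : ℝ) ^ 2 + 143 * ((((P.d + 4) * P.L : ℕ) : ℝ) ^ 2 / 4) ^ 2 + 6 * ((((P.d + 2) * P.L : ℕ) : ℝ) ^ 2 / 4) + P.L) ^ j *
        ((1 + ((P.d - 1 : ℕ) : ℝ) * n₀) * θ) ≤ 1)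
    (hwinδ : ((((P.d + 4) * P.L : ℕ) : ℝ) ^ 2 / 4) *
        (((P.L : ℝ) ^ 2 + 143 * ((((P.d + 4) * P.L : ℕ) : ℝ) ^ 2 / 4) ^ 2 + 6 * ((((P.d + 2) * P.L : ℕ) : ℝ) ^ 2 / 4) + P.L) ^ j *
          ((1 + ((P.d - 1 : ℕ) : ℝ) * n₀) * θ)) ≤ deltaSU (Fin 2) / 2) :
    GaugeGroup.dist1 (GaugeField.plaqHol (Averaging.iter (fun i' => blockAvg (P := P) (j := i') (expMeanLogSU (n := Fin 2))) j U) a)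
        ≤ ∑ α : Fin 3, |∑ p : Plaq P 0, linWeight j a p * ((I • pauli α) *
              (((GaugeField.plaqHol (GaugeField.gaugeAct (axialGauge U lo hi) U) p : Matrix.specialUnitaryGroup (Fin 2) ℂ) :
                Matrix (Fin 2) (Fin 2) ℂ) - 1)).trace.re|
          + (1 / 2) * ((P.L : ℝ) * P.L) ^ j * θ ^ 2
          + (143 * ((((P.d + 4) * P.L : ℕ) : ℝ) ^ 2 / 4) ^ 2 + (P.L : ℝ) ^ 4 + 2 * (((P.d + 4) * P.L : ℕ) : ℝ) * (P.L : ℝ) ^ 2) *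
              (((P.L : ℝ) ^ 2 + 143 * ((((P.d + 4) * P.L : ℕ) : ℝ) ^ 2 / 4) ^ 2 + 6 * ((((P.d + 2) * P.L : ℕ) : ℝ) ^ 2 / 4) + P.L) ^ 2 +
                  ((P.L : ℝ) ^ 2 + 2 * (((P.d + 4) * P.L : ℕ) : ℝ) * (P.L : ℝ) ^ 2)) ^ j *
                ((1 + ((P.d - 1 : ℕ) : ℝ) * n₀) * θ) ^ 2 ∧
      0 ≤ (143 * ((((P.d + 4) * P.L : ℕ) : ℝ) ^ 2 / 4) ^ 2 + (P.L : ℝ) ^ 4 + 2 * (((P.d + 4) * P.L : ℕ) : ℝ) * (P.L : ℝ) ^ 2) *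
              (((P.L : ℝ) ^ 2 + 143 * ((((P.d + 4) * P.L : ℕ) : ℝ) ^ 2 / 4) ^ 2 + 6 * ((((P.d + 2) * P.L : ℕ) : ℝ) ^ 2 / 4) + P.L) ^ 2 +
                  ((P.L : ℝ) ^ 2 + 2 * (((P.d + 4) * P.L : ℕ) : ℝ) * (P.L : ℝ) ^ 2)) ^ j *
                ((1 + ((P.d - 1 : ℕ) : ℝ) * n₀) * θ) ^ 2 := by
  -- (P1a) dressing invariance of the target
  have hP1a : GaugeGroup.dist1 (GaugeField.plaqHol (Averaging.iter (fun i' => blockAvg (P := P) (j := i') (expMeanLogSU (n := Fin 2))) j U) a) =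
      GaugeGroup.dist1 (GaugeField.plaqHol (Averaging.iter (fun i' => blockAvg (P := P) (j := i') (expMeanLogSU (n := Fin 2))) j
        (GaugeField.gaugeAct (axialGauge U lo hi) U)) a) :=
    (dist1_plaqHol_iter_dressed (fun i' => blockAvg (P := P) (j := i') (expMeanLogSU (n := Fin 2))) (fun U => axialGauge U lo hi) hjK U a).symm
  -- (P1b) P-LOC at the cone's plaquette, then at `a`
  have hP1b := norm_iter_plaqHol_sub_one_sub_linProxy_le_of_plaqSmallOn_box (n := Fin 2) U hn hnN hθ hU c hc z₀ hz hlo hhi hwin hwinδ a.μ a.ν a.hμν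
  rw [plaq_eq_of_cone a c hcj] at hP1b
  -- (P2) the proxy read in `dist₁` letters
  have hread := dist1_le_pauli_read Finset.univ (fun p => linWeight j a p) (fun p => GaugeField.plaqHol (GaugeField.gaugeAct (axialGauge U lo hi) U) p) _ hP1b
  -- the second-order term
  have hQ := half_sum_abs_mul_sq_le Finset.univ (fun p => linWeight j a p)
    (fun p => GaugeGroup.dist1 (GaugeField.plaqHol (GaugeField.gaugeAct (axialGauge U lo hi) U) p))
    (fun p _ => linWeight_nonneg j a p) (fun p _ => GaugeGroup.dist1_nonneg _)
    (fun p _ hp => dist1_plaqHol_le_of_linWeight_ne_zero U hU a c hcj hc z₀ hz hlo hhi p hp)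
  rw [sum_linWeight j a] at hQ
  refine ⟨?_, hread.2⟩
  rw [hP1a]
  linarith [hread.1, hQ]

end Summit.QuantumFields.YangMills.Theorems.GrossTransferStubLinTestProxySide

end
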